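import Summits.Ventures.DiscreteObjects.MOLS.TargetMOLS10
import Summits.Ventures.DiscreteObjects.MOLS.PlaneOfMOLS
import Summits.Ventures.DiscreteObjects.Verify.Pair10
import Summits.Ventures.DiscreteObjects.Verify.SOLS10

/-!
# Soundness of verify-ref's Bool checker `isMOLS`: certificates ⇒ census statements (kernel glue)
Framing: lottery ticket; floor = certified bounds/negative ranges.

Cell pub-namedobj (venture DiscreteObjects), target (M), designs gen 9.  verify-ref's `Verify.isMOLS` (`DesignsKernel`) is a
Bool computation on squares given as lists of rows; the census statements (`ExistsThreeMOLS10`, `ExistsProjectivePlaneOrder12`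
⇔ 11 MOLS(12), the floor facts) speak the Literature predicates `IsLatinSquare` / `IsOrthogonalMate` on `Fin n → Fin n → Fin n`.
This file proves the checker SOUND — **`isLatinSquare_listSq`**, **`isOrthogonalMate_listSq`**, **`isMOLS_sound`**: if
`isMOLS Ls = true` and every square in `Ls` has `n` rows then the squares `listSq n L` read off the lists are Latin and pairwise
orthogonal — so that a HIT certificate is ONE Bool `decide`/`native_decide` plus a theorem of this file:
**`existsThreeMOLS10_of_isMOLS`** (target (M-a)), **`existsPlaneOrder12_of_isMOLS`** (target (M-b), through
`existsPlaneOrder12_iff_eleven_MOLS`).  Applied to the replayed controls: **`two_MOLS_ten`** — `2 ≤ N(10)`, the lower end of the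
MOLS(10) floor, as a Prop-level kernel theorem from `Verify.pair10_isMOLS` (Parker 1959 / Bose–Shrikhande–Parker 1960 on an explicit
object); **`sols10_isLatinSquare`**, **`sols10_orthogonal_transpose`** — the explicit SOLS(10) of `Verify.SOLS10` in Literature vocabulary.
Glue only; no new mathematics; no `sorry`.
-/

namespace Summit.Ventures.DiscreteObjects.MOLS

open Function List Literature.Combinatorics.Designs.LatinSquares Summit.Ventures.DiscreteObjects.Verify

/-! ### rows that pass `isPerm` are permutations of `0 … n-1` -/

/-- a list of length `n` containing every `s < n` is a permutation of `range n` -/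
theorem perm_range_of_isPerm {n : ℕ} {r : List ℕ} (h : isPerm n r = true) : r ~ range n := by
  simp only [Verify.isPerm, Bool.and_eq_true, decide_eq_true_eq, all_eq_true, contains_iff_mem, mem_range] at h
  obtain ⟨hlen, hall⟩ := h
  have hsub : range n ⊆ r := fun s hs => hall s (mem_range.mp hs)
  have hsp : range n <+~ r := subperm_of_subset (nodup_range) hsub
  exact (hsp.perm_of_length_le (by rw [hlen, length_range])).symm

/-- entries of an `isPerm` row are `< n` -/
theorem lt_of_isPerm {n : ℕ} {r : List ℕ} (h : isPerm n r = true) {j : ℕ} (hj : j < r.length) : r[j] < n :=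
  mem_range.mp ((perm_range_of_isPerm h).mem_iff.mp (getElem_mem hj))

/-- an `isPerm` row has no repeated entry -/
theorem nodup_of_isPerm {n : ℕ} {r : List ℕ} (h : isPerm n r = true) : r.Nodup :=
  (perm_range_of_isPerm h).nodup_iff.mpr (nodup_range)

/-- an `isPerm n` row has length `n` -/
theorem length_of_isPerm {n : ℕ} {r : List ℕ} (h : isPerm n r = true) : r.length = n := by
  simp only [Verify.isPerm, Bool.and_eq_true, decide_eq_true_eq] at h
  exact h.1

/-! ### the square read off a list of rows -/

/-- the entry `(i, j)` of a square given as a list of rows (verify-ref's convention: default `0`) -/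
def entry (L : List (List ℕ)) (i j : ℕ) : ℕ := (L.getD i []).getD j 0

/-- the square `Fin n → Fin n → Fin n` read off a list of rows (entries reduced mod `n`, the identity on a Latin square) -/
def listSq (n : ℕ) (L : List (List ℕ)) : Fin n → Fin n → Fin n :=
  fun i j => ⟨entry L i j % n, Nat.mod_lt _ i.pos⟩

section Latin

variable {n : ℕ} {L : List (List ℕ)}

/-- unpack `isLatin`: every row and every column passes `isPerm n`, `n = L.length` -/
theorem isLatin_iff' : isLatin L = true ↔
    (∀ r ∈ L, isPerm L.length r = true) ∧ ∀ j < L.length, isPerm L.length (column L j) = true := by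
  simp only [isLatin, Bool.and_eq_true, all_eq_true, mem_range]

/-- in a square passing `isLatin`, the entry `(i, j)` is the `j`-th element of the `i`-th row -/
theorem entry_eq_getElem (h : isLatin L = true) {i j : ℕ} (hi : i < L.length) (hj : j < L.length) :
    ∃ hj' : j < (L[i]).length, entry L i j = (L[i])[j]'hj' := by
  have hrow : isPerm L.length (L[i]) = true := (isLatin_iff'.mp h).1 _ (getElem_mem hi)
  have hl : (L[i]).length = L.length := length_of_isPerm hrow
  refine ⟨by rw [hl]; exact hj, ?_⟩
  simp only [entry, getD_eq_getElem L [] hi, getD_eq_getElem (L[i]) 0 (by rw [hl]; exact hj)]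

/-- entries of a square passing `isLatin` are `< n` -/
theorem entry_lt (h : isLatin L = true) {i j : ℕ} (hi : i < L.length) (hj : j < L.length) : entry L i j < L.length := by
  obtain ⟨hj', e⟩ := entry_eq_getElem h hi hj
  rw [e]
  exact lt_of_isPerm ((isLatin_iff'.mp h).1 _ (getElem_mem hi)) hj'

/-- rows of a square passing `isLatin` have distinct entries -/
theorem entry_row_inj (h : isLatin L = true) {i j j' : ℕ} (hi : i < L.length) (hj : j < L.length) (hj' : j' < L.length)
    (e : entry L i j = entry L i j') : j = j' := by
  obtain ⟨h1, e1⟩ := entry_eq_getElem h hi hj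
  obtain ⟨h2, e2⟩ := entry_eq_getElem h hi hj'
  rw [e1, e2] at e
  exact (nodup_of_isPerm ((isLatin_iff'.mp h).1 _ (getElem_mem hi))).getElem_inj_iff.mp e

/-- the `i`-th element of `column L j` is the entry `(i, j)` -/
theorem getElem_column {i j : ℕ} (hi : i < (column L j).length) : (column L j)[i] = entry L i j := by
  have hi' : i < L.length := by simpa [column] using hi
  simp only [column, getElem_map, entry, getD_eq_getElem L [] hi']

/-- columns of a square passing `isLatin` have distinct entries -/
theorem entry_col_inj (h : isLatin L = true) {i i' j : ℕ} (hi : i < L.length) (hi' : i' < L.length) (hj : j < L.length)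
    (e : entry L i j = entry L i' j) : i = i' := by
  have hcol : isPerm L.length (column L j) = true := (isLatin_iff'.mp h).2 j hj
  have hlen : (column L j).length = L.length := by simp [column]
  have e' : (column L j)[i]'(by rw [hlen]; exact hi) = (column L j)[i']'(by rw [hlen]; exact hi') := by
    rw [getElem_column, getElem_column]; exact e
  exact (nodup_of_isPerm hcol).getElem_inj_iff.mp e'

/-- **Soundness of `isLatin`:** a list of `n` rows passing `isLatin` reads as a Latin square of order `n`. -/
theorem isLatinSquare_listSq (h : isLatin L = true) (hn : L.length = n) : IsLatinSquare (listSq n L) := by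
  subst hn
  refine ⟨fun i => ?_, fun j => ?_⟩
  · intro j j' e
    simp only [listSq, Fin.mk.injEq] at e
    rw [Nat.mod_eq_of_lt (entry_lt h i.2 j.2), Nat.mod_eq_of_lt (entry_lt h i.2 j'.2)] at e
    exact Fin.ext (entry_row_inj h i.2 j.2 j'.2 e)
  · intro i i' e
    simp only [listSq, Fin.mk.injEq] at e
    rw [Nat.mod_eq_of_lt (entry_lt h i.2 j.2), Nat.mod_eq_of_lt (entry_lt h i'.2 j.2)] at e
    exact Fin.ext (entry_col_inj h i.2 i'.2 j.2 e)

end Latin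

section Orthogonal

variable {n : ℕ} {A B : List (List ℕ)}

/-- **Soundness of `orthogonal`:** if the `n²` entry pairs are `Nodup` then the squares read off `A`, `B` are orthogonal. -/
theorem isOrthogonalMate_listSq (hA : isLatin A = true) (hB : isLatin B = true) (hnA : A.length = n) (hnB : B.length = n)
    (h : Verify.orthogonal A B = true) : IsOrthogonalMate (listSq n A) (listSq n B) := by
  subst hnA
  simp only [Verify.orthogonal, decide_eq_true_eq] at h
  rw [nodup_flatMap] at h
  obtain ⟨hin, hdis⟩ := h
  have hmem : ∀ (i j : ℕ), j < A.length →
      (entry A i j, entry B i j) ∈ (range A.length).map (fun j => ((A.getD i []).getD j 0, (B.getD i []).getD j 0)) :=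
    fun i j hj => mem_map.mpr ⟨j, mem_range.mpr hj, rfl⟩
  have hd : ∀ {a b : ℕ}, a < A.length → b < A.length → a < b →
      List.Disjoint ((range A.length).map fun j => ((A.getD a []).getD j 0, (B.getD a []).getD j 0))
        ((range A.length).map fun j => ((A.getD b []).getD j 0, (B.getD b []).getD j 0)) := by
    intro a b ha hb hab
    have := (pairwise_iff_getElem.mp hdis) a b (by simpa using ha) (by simpa using hb) hab
    simpa [Function.onFun] using this
  rintro ⟨i, j⟩ ⟨i', j'⟩ e
  simp only [Prod.mk.injEq, listSq, Fin.mk.injEq] at e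
  obtain ⟨e1, e2⟩ := e
  rw [Nat.mod_eq_of_lt (entry_lt hA i.2 j.2), Nat.mod_eq_of_lt (entry_lt hA i'.2 j'.2)] at e1
  have hBl : ∀ {a b : Fin A.length}, entry B a b < A.length := fun {a b} => by
    have := entry_lt hB (by rw [hnB]; exact a.2) (by rw [hnB]; exact b.2); rwa [hnB] at this
  rw [Nat.mod_eq_of_lt hBl, Nat.mod_eq_of_lt hBl] at e2
  by_cases hii : (i : ℕ) = i'
  · -- same row: the row's pair list is `Nodup`
    have hnd := hin i (mem_range.mpr i.2)
    rw [nodup_map_iff_inj_on nodup_range] at hnd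
    have hjj : (j : ℕ) = j' := hnd j (mem_range.mpr j.2) j' (mem_range.mpr j'.2) (by
      show (entry A i j, entry B i j) = (entry A i j', entry B i j')
      rw [e1, e2, hii])
    exact Prod.ext (Fin.ext hii) (Fin.ext hjj)
  · -- different rows: their pair lists are disjoint
    exfalso
    rcases Nat.lt_or_gt_of_ne hii with hlt | hgt
    · exact disjoint_left.mp (hd i.2 i'.2 hlt) (hmem i j j.2) (by rw [e1, e2]; exact hmem i' j' j'.2)
    · exact disjoint_left.mp (hd i'.2 i.2 hgt) (hmem i' j' j'.2) (by rw [← e1, ← e2]; exact hmem i j j.2)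

end Orthogonal

/-! ### `isMOLS` -/

/-- unpack `isMOLS`: all squares pass `isLatin`, and `orthogonal` is checked for every index pair `a < b` -/
theorem isMOLS_iff' {Ls : List (List (List ℕ))} : isMOLS Ls = true ↔
    (∀ L ∈ Ls, isLatin L = true) ∧
      ∀ a < Ls.length, ∀ b < Ls.length, a < b → Verify.orthogonal (Ls.getD a []) (Ls.getD b []) = true := by
  simp only [isMOLS, Bool.and_eq_true, all_eq_true, mem_range, Bool.or_eq_true, decide_eq_true_eq]
  constructor
  · rintro ⟨h1, h2⟩
    refine ⟨h1, fun a ha b hb hab => ?_⟩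
    rcases h2 a ha b hb with h | h
    · omega
    · exact h
  · rintro ⟨h1, h2⟩
    refine ⟨h1, fun a ha b hb => ?_⟩
    by_cases hab : a < b
    · exact Or.inr (h2 a ha b hb hab)
    · exact Or.inl (by omega)

/-- **Soundness of `isMOLS`:** a list of squares with `n` rows each passing `isMOLS` reads as a family of Latin squares of
order `n` that are pairwise orthogonal (Literature predicates). -/
theorem isMOLS_sound {n : ℕ} {Ls : List (List (List ℕ))} (h : isMOLS Ls = true) (hlen : ∀ L ∈ Ls, L.length = n) :
    (∀ a : Fin Ls.length, IsLatinSquare (listSq n (Ls[(a : ℕ)]))) ∧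
      ∀ a b : Fin Ls.length, a ≠ b → IsOrthogonalMate (listSq n (Ls[(a : ℕ)])) (listSq n (Ls[(b : ℕ)])) := by
  obtain ⟨hlat, horth⟩ := isMOLS_iff'.mp h
  have hl : ∀ a : Fin Ls.length, isLatin (Ls[(a : ℕ)]) = true := fun a => hlat _ (getElem_mem a.2)
  have hn : ∀ a : Fin Ls.length, (Ls[(a : ℕ)]).length = n := fun a => hlen _ (getElem_mem a.2)
  refine ⟨fun a => isLatinSquare_listSq (hl a) (hn a), fun a b hab => ?_⟩
  have key : ∀ a b : Fin Ls.length, (a : ℕ) < b →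
      IsOrthogonalMate (listSq n (Ls[(a : ℕ)])) (listSq n (Ls[(b : ℕ)])) := by
    intro a b hab'
    have := horth a a.2 b b.2 hab'
    rw [getD_eq_getElem Ls [] a.2, getD_eq_getElem Ls [] b.2] at this
    exact isOrthogonalMate_listSq (hl a) (hl b) (hn a) (hn b) this
  rcases lt_trichotomy (a : ℕ) b with hlt | heq | hgt
  · exact key a b hlt
  · exact absurd (Fin.ext heq) hab
  · exact isOrthogonalMate_symm (key b a hgt)

/-! ### Certificates ⇒ census statements -/

/-- the family of squares read off a certificate list, indexed by `Fin Ls.length` -/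
def listFamily (n : ℕ) (Ls : List (List (List ℕ))) : Fin Ls.length → Fin n → Fin n → Fin n :=
  fun a => listSq n (Ls[(a : ℕ)])

/-- **HIT protocol (M-a):** three squares of order 10 passing `isMOLS` prove `ExistsThreeMOLS10`. -/
theorem existsThreeMOLS10_of_isMOLS (Ls : List (List (List ℕ))) (h3 : Ls.length = 3) (hlen : ∀ L ∈ Ls, L.length = 10)
    (h : isMOLS Ls = true) : ExistsThreeMOLS10 := by
  obtain ⟨hL, hO⟩ := isMOLS_sound h hlen
  refine ⟨fun k => listFamily 10 Ls (k.cast h3.symm), fun k => hL _, fun k k' hkk => hO _ _ ?_⟩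
  intro e
  exact hkk (by simpa using congrArg (Fin.cast h3) e)

/-- **HIT protocol (M-b):** eleven squares of order 12 passing `isMOLS` prove `ExistsProjectivePlaneOrder12`. -/
theorem existsPlaneOrder12_of_isMOLS (Ls : List (List (List ℕ))) (h11 : Ls.length = 11) (hlen : ∀ L ∈ Ls, L.length = 12)
    (h : isMOLS Ls = true) : ExistsProjectivePlaneOrder12 := by
  obtain ⟨hL, hO⟩ := isMOLS_sound h hlen
  refine existsPlaneOrder12_iff_eleven_MOLS.2 ⟨fun k => listFamily 12 Ls (k.cast h11.symm), fun k => hL _, fun k k' hkk => hO _ _ ?_⟩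
  intro e
  exact hkk (by simpa using congrArg (Fin.cast h11) e)

/-- a general certificate lemma: `m` squares of order `n` passing `isMOLS` give `m` MOLS(n) indexed by `Fin m` -/
theorem exists_MOLS_of_isMOLS {m n : ℕ} (Ls : List (List (List ℕ))) (hm : Ls.length = m) (hlen : ∀ L ∈ Ls, L.length = n)
    (h : isMOLS Ls = true) :
    ∃ F : Fin m → Fin n → Fin n → Fin n, (∀ k, IsLatinSquare (F k)) ∧ ∀ k k', k ≠ k' → IsOrthogonalMate (F k) (F k') := by
  obtain ⟨hL, hO⟩ := isMOLS_sound h hlen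
  refine ⟨fun k => listFamily n Ls (k.cast hm.symm), fun k => hL _, fun k k' hkk => hO _ _ ?_⟩
  intro e
  exact hkk (by simpa using congrArg (Fin.cast hm) e)

/-! ### The replayed controls in Literature vocabulary -/

/-- **`2 ≤ N(10)` (kernel, Prop level):** there are two orthogonal Latin squares of order 10 — the explicit pair of
`Verify.Pair10` (existence: Parker 1959; Bose–Shrikhande–Parker 1960), transported by `isMOLS_sound`. -/
theorem two_MOLS_ten :
    ∃ F : Fin 2 → Fin 10 → Fin 10 → Fin 10, (∀ k, IsLatinSquare (F k)) ∧ ∀ k k', k ≠ k' → IsOrthogonalMate (F k) (F k') :=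
  exists_MOLS_of_isMOLS [pair10L, pair10M] rfl (by decide) pair10_isMOLS

/-- the explicit square `pair10L` is Latin (Literature predicate) -/
theorem pair10L_isLatinSquare : IsLatinSquare (listSq 10 pair10L) :=
  (isMOLS_sound (n := 10) pair10_isMOLS (by decide)).1 ⟨0, by decide⟩

/-- the explicit squares `pair10L`, `pair10M` are orthogonal (Literature predicate) -/
theorem pair10_isOrthogonalMate : IsOrthogonalMate (listSq 10 pair10L) (listSq 10 pair10M) :=
  (isMOLS_sound (n := 10) pair10_isMOLS (by decide)).2 ⟨0, by decide⟩ ⟨1, by decide⟩ (by decide)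

/-- the explicit `sols10` is a Latin square (Literature predicate) -/
theorem sols10_isLatinSquare : IsLatinSquare (listSq 10 sols10) :=
  (isMOLS_sound (n := 10) sols10_selfOrthogonal (by decide)).1 ⟨0, by decide⟩

/-- the transpose read off `transposeSq sols10` is the transpose of the square read off `sols10` -/
theorem listSq_transposeSq_sols10 : listSq 10 (transposeSq sols10) = fun i j => listSq 10 sols10 j i := by
  funext i j
  revert i j
  decide

/-- **SOLS(10) in Literature vocabulary:** `sols10` is orthogonal to its transpose. -/
theorem sols10_orthogonal_transpose : IsOrthogonalMate (listSq 10 sols10) (fun i j => listSq 10 sols10 j i) := by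
  rw [← listSq_transposeSq_sols10]
  exact (isMOLS_sound (n := 10) sols10_selfOrthogonal (by decide)).2 ⟨0, by decide⟩ ⟨1, by decide⟩ (by decide)

end Summit.Ventures.DiscreteObjects.MOLS
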